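import Literature.Analysis.Distribution.LogWeightSchwartz
import HarnessLib

/-!
# Log-weight Schwartz functions of a family: seminorms polynomial in the parameter

Analysis/Distribution support file (everything proved), sequel of `LogWeightSchwartz`. For a family
`F p : ℝ → ℂ` whose derivatives decay super-exponentially with constants *polynomial in `p`*,
`‖Dʲ(F p)(s)‖ ≤ C (1+|p|)ᴰ e^{cs}` (`SuperExpDecayFamily`), the Schwartz functions
`u ↦ (F p)(log u)/u` have all Schwartz seminorms bounded by `C (1+|p|)ᴰ`
(`seminorm_logWeightSchwartz_family_le`). The modulated Gaussians
`F p (s) = e^{-bs²} e^{-2πips}` are such a family (`superExpDecayFamily_gaussMod`), which is the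
input "polynomial bounds in the frequencies" of the flat tube theorem for the limiting functional of
the Osterwalder–Schrader continuation (Comm. Math. Phys. 42 (1975), Ch. V–VI).

## References

* K. Osterwalder, R. Schrader, *Axioms for Euclidean Green's functions II*, Comm. Math. Phys.
  42 (1975) 281–305, Ch. VI.1. [OsterwalderSchraderCMP1975]
-/

noncomputable section

open Set Filter
open scoped Topology

namespace Literature.Analysis.Distribution

/-- **Super-exponential decay of all derivatives, polynomially in a parameter**:
`‖Dʲ(F p)(s)‖ ≤ C (1+|p|)ᴰ e^{cs}` for all `j`, all real `c`. [folklore] -/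
def SuperExpDecayFamily (F : ℝ → ℝ → ℂ) : Prop :=
  ∀ (j : ℕ) (c : ℝ), ∃ (C : ℝ) (D : ℕ), ∀ p s, ‖iteratedDeriv j (F p) s‖ ≤ C * (1 + |p|) ^ D * Real.exp (c * s)

/-- Each member of such a family has `SuperExpDecay`. [folklore] -/
theorem SuperExpDecayFamily.superExpDecay {F : ℝ → ℝ → ℂ} (h : SuperExpDecayFamily F) (p : ℝ) :
    SuperExpDecay (F p) := fun j c => by
  obtain ⟨C, D, hC⟩ := h j c
  exact ⟨C * (1 + |p|) ^ D, fun s => hC p s⟩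

/-- The family property passes to the log-pullbacks, with polynomial constants. [folklore] -/
theorem superExpDecayFamily_logPullback {F : ℝ → ℝ → ℂ} (hF : ∀ p, ContDiff ℝ (⊤ : ℕ∞) (F p))
    (hdec : SuperExpDecayFamily F) (n : ℕ) :
    SuperExpDecayFamily fun p => logPullback (F p) n := by
  induction n with
  | zero => exact hdec
  | succ n ih =>
      intro j c
      obtain ⟨C₁, D₁, hC₁⟩ := ih (j + 1) c
      obtain ⟨C₂, D₂, hC₂⟩ := ih j c
      refine ⟨|C₁| + ((n : ℝ) + 1) * |C₂|, max D₁ D₂, fun p s => ?_⟩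
      have hsmooth : ContDiff ℝ (⊤ : ℕ∞) (logPullback (F p) n) := contDiff_logPullback (hF p) n
      have hfun : logPullback (F p) (n + 1) =
          deriv (logPullback (F p) n) - fun s => ((n : ℂ) + 1) * logPullback (F p) n s := by
        funext s; rfl
      have hd : ContDiffAt ℝ j (deriv (logPullback (F p) n)) s :=
        ((contDiff_deriv_of_top hsmooth).of_le (natCast_le_top' _)).contDiffAt
      have hm : ContDiffAt ℝ j (fun s => ((n : ℂ) + 1) * logPullback (F p) n s) s :=
        (contDiffAt_const.mul (hsmooth.of_le (natCast_le_top' _)).contDiffAt)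
      beta_reduce at hC₁ hC₂ ⊢
      rw [hfun, iteratedDeriv_sub hd hm, ← iteratedDeriv_succ',
        iteratedDeriv_const_mul _ ((hsmooth.of_le (natCast_le_top' _)).contDiffAt)]
      refine (norm_sub_le _ _).trans ?_
      have hp1 : (1 : ℝ) ≤ 1 + |p| := by linarith [abs_nonneg p]
      have e1 : (1 + |p|) ^ D₁ ≤ (1 + |p|) ^ max D₁ D₂ := pow_le_pow_right₀ hp1 (le_max_left _ _)
      have e2 : (1 + |p|) ^ D₂ ≤ (1 + |p|) ^ max D₁ D₂ := pow_le_pow_right₀ hp1 (le_max_right _ _)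
      have hn : ‖((n : ℂ) + 1)‖ = (n : ℝ) + 1 := by
        rw [show ((n : ℂ) + 1) = ((n + 1 : ℕ) : ℂ) by push_cast; ring, Complex.norm_natCast]
        push_cast
        ring
      rw [norm_mul, hn]
      set X : ℝ := (1 + |p|) ^ max D₁ D₂ * Real.exp (c * s) with hX
      have hX0 : 0 ≤ X := by positivity
      have a1 : ‖iteratedDeriv (j + 1) (logPullback (F p) n) s‖ ≤ |C₁| * X := by
        refine (hC₁ p s).trans ?_
        rw [hX, ← mul_assoc]
        refine mul_le_mul ?_ le_rfl (Real.exp_pos _).le (by positivity)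
        exact mul_le_mul (le_abs_self _) e1 (by positivity) (abs_nonneg _)
      have a2 : ‖iteratedDeriv j (logPullback (F p) n) s‖ ≤ |C₂| * X := by
        refine (hC₂ p s).trans ?_
        rw [hX, ← mul_assoc]
        refine mul_le_mul ?_ le_rfl (Real.exp_pos _).le (by positivity)
        exact mul_le_mul (le_abs_self _) e2 (by positivity) (abs_nonneg _)
      have a3 : ((n : ℝ) + 1) * ‖iteratedDeriv j (logPullback (F p) n) s‖ ≤ ((n : ℝ) + 1) * (|C₂| * X) :=
        mul_le_mul_of_nonneg_left a2 (by positivity)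
      have hRHS : (|C₁| + ((n : ℝ) + 1) * |C₂|) * (1 + |p|) ^ max D₁ D₂ * Real.exp (c * s) =
          |C₁| * X + ((n : ℝ) + 1) * (|C₂| * X) := by rw [hX]; ring
      rw [hRHS]
      linarith

/-- **Schwartz decay of the log-weight functions of a family, polynomially in the parameter.** [folklore] -/
theorem decay_logWeightFun_family {F : ℝ → ℝ → ℂ} (hF : ∀ p, ContDiff ℝ (⊤ : ℕ∞) (F p))
    (hdec : SuperExpDecayFamily F) (k n : ℕ) :
    ∃ (C : ℝ) (D : ℕ), 0 ≤ C ∧ ∀ p u, |u| ^ k * ‖iteratedDeriv n (logWeightFun (F p)) u‖ ≤ C * (1 + |p|) ^ D := by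
  obtain ⟨C, D, hC⟩ := superExpDecayFamily_logPullback hF hdec n 0 ((n : ℝ) + 1 - k)
  have hC0 : 0 ≤ C := by
    have h := hC 0 0
    simp only [iteratedDeriv_zero, mul_zero, Real.exp_zero, mul_one, abs_zero, add_zero, one_pow] at h
    exact (norm_nonneg _).trans h
  refine ⟨C, D, hC0, fun p u => ?_⟩
  rw [iteratedDeriv_logWeightFun (hF p) (hdec.superExpDecay p) n]
  rcases le_or_gt u 0 with hu | hu
  · rw [logWeightDer, if_neg (not_lt.2 hu), norm_zero, mul_zero]; positivity
  · rw [logWeightDer, if_pos hu, norm_div, norm_pow, Complex.norm_real, Real.norm_eq_abs, abs_of_pos hu]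
    have h := hC p (Real.log u)
    rw [iteratedDeriv_zero] at h
    have hexp : Real.exp (((n : ℝ) + 1 - k) * Real.log u) = u ^ (n + 1) / u ^ k := by
      rw [sub_mul, Real.exp_sub, ← Real.log_rpow hu, Real.exp_log (Real.rpow_pos_of_pos hu _),
        ← Real.log_rpow hu, Real.exp_log (Real.rpow_pos_of_pos hu _)]
      norm_cast
    rw [hexp] at h
    have hupos : 0 < u ^ (n + 1) := pow_pos hu _
    have hukpos : 0 < u ^ k := pow_pos hu _
    rw [mul_div_assoc', div_le_iff₀ hupos]
    calc u ^ k * ‖logPullback (F p) n (Real.log u)‖ ≤ u ^ k * (C * (1 + |p|) ^ D * (u ^ (n + 1) / u ^ k)) :=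
          mul_le_mul_of_nonneg_left h hukpos.le
      _ = C * (1 + |p|) ^ D * u ^ (n + 1) := by field_simp

/-- **Seminorms of the log-weight Schwartz functions of a family are polynomial in the parameter.** [folklore] -/
theorem seminorm_logWeightSchwartz_family_le {F : ℝ → ℝ → ℂ} (hF : ∀ p, ContDiff ℝ (⊤ : ℕ∞) (F p))
    (hdec : SuperExpDecayFamily F) (k n : ℕ) :
    ∃ (C : ℝ) (D : ℕ), 0 ≤ C ∧ ∀ p,
      SchwartzMap.seminorm ℝ k n (logWeightSchwartz (F p) (hF p) (hdec.superExpDecay p)) ≤ C * (1 + |p|) ^ D := by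
  obtain ⟨C, D, hC0, hC⟩ := decay_logWeightFun_family hF hdec k n
  exact ⟨C, D, hC0, fun p => seminorm_logWeightSchwartz_le (F p) (hF p) (hdec.superExpDecay p) k n (by positivity) (hC p)⟩

/-! ### The modulated Gaussians -/

/-- The **modulated Gaussian profiles** `F p (s) = e^{-bs²} e^{-2πips}`. [folklore] -/
def gaussModProfile (b p : ℝ) (s : ℝ) : ℂ :=
  Complex.exp (-(b : ℂ) * (s : ℂ) ^ 2) * Complex.exp (↑(-2 * Real.pi * s * p) * Complex.I)

/-- The modulated Gaussians are smooth. [folklore] -/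
theorem contDiff_gaussModProfile (b p : ℝ) : ContDiff ℝ (⊤ : ℕ∞) (gaussModProfile b p) := by
  unfold gaussModProfile
  refine contDiff_gaussian_mul b ?_
  have hfun : (fun s : ℝ => Complex.exp (↑(-2 * Real.pi * s * p) * Complex.I)) =
      fun s : ℝ => Complex.exp ((↑(-2 * Real.pi * p) * Complex.I) * (s : ℂ)) := by
    funext s; congr 1; push_cast; ring
  rw [hfun]
  exact Complex.contDiff_exp.comp (contDiff_const.mul Complex.ofRealCLM.contDiff)

/-- **The modulated Gaussians form a super-exponentially decaying family with polynomial constants.** [folklore] -/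
theorem superExpDecayFamily_gaussMod {b : ℝ} (hb : 0 < b) : SuperExpDecayFamily (gaussModProfile b) := by
  intro j c
  refine ⟨(1 + 2 * Real.pi) ^ j * (1 + 2 * |b| * (1 + j)) ^ j * Real.exp ((((0 + j : ℕ) : ℝ) + |c|) ^ 2 / (4 * b)), j,
    fun p s => ?_⟩
  have hmod : ContDiff ℝ (⊤ : ℕ∞) (fun s : ℝ => Complex.exp (↑(-2 * Real.pi * s * p) * Complex.I)) := by
    have hfun : (fun s : ℝ => Complex.exp (↑(-2 * Real.pi * s * p) * Complex.I)) =
        fun s : ℝ => Complex.exp ((↑(-2 * Real.pi * p) * Complex.I) * (s : ℂ)) := by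
      funext s; congr 1; push_cast; ring
    rw [hfun]
    exact Complex.contDiff_exp.comp (contDiff_const.mul Complex.ofRealCLM.contDiff)
  have h := norm_iteratedDeriv_gaussian_mul_le hb hmod j (A := (1 + 2 * Real.pi * |p|) ^ j) (N := 0)
    (fun m hm s => norm_iteratedDeriv_modulation_le p hm s) c s
  refine h.trans ?_
  have hp : (1 + 2 * Real.pi * |p|) ^ j ≤ (1 + 2 * Real.pi) ^ j * (1 + |p|) ^ j := by
    rw [← mul_pow]
    refine pow_le_pow_left₀ (by positivity) ?_ j
    nlinarith [Real.pi_pos, abs_nonneg p]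
  have hrest : 0 ≤ (1 + 2 * |b| * (1 + (j : ℝ))) ^ j * Real.exp ((((0 + j : ℕ) : ℝ) + |c|) ^ 2 / (4 * b)) * Real.exp (c * s) := by
    positivity
  calc (1 + 2 * Real.pi * |p|) ^ j * (1 + 2 * |b| * (1 + j)) ^ j * Real.exp ((((0 + j : ℕ) : ℝ) + |c|) ^ 2 / (4 * b)) *
        Real.exp (c * s)
      = (1 + 2 * Real.pi * |p|) ^ j * ((1 + 2 * |b| * (1 + j)) ^ j * Real.exp ((((0 + j : ℕ) : ℝ) + |c|) ^ 2 / (4 * b)) *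
        Real.exp (c * s)) := by ring
    _ ≤ ((1 + 2 * Real.pi) ^ j * (1 + |p|) ^ j) * ((1 + 2 * |b| * (1 + j)) ^ j *
        Real.exp ((((0 + j : ℕ) : ℝ) + |c|) ^ 2 / (4 * b)) * Real.exp (c * s)) := mul_le_mul_of_nonneg_right hp hrest
    _ = _ := by ring

end Literature.Analysis.Distribution
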